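import Summits.QuantumAdvantage.QuantumAdvantage.Theorems.NearExactIsExact.Negative.HyperplaneLeak
import Literature.Computability.QuantumComplexity.MSubspaceSignReadoutRelaxedRuns
import Literature.Computability.QuantumComplexity.ForrelationSignTransport
import Summits.QuantumAdvantage.QuantumAdvantage.Theorems.NearExactIsExact.Negative.SmallCasesAnf

/-!
# `NearExactIsExact` (stmt-QuantumAdvantage-14043) — negative-side structural lemma (disprove, gen 29):
  the DERIVATIVE-BIAS BOUND — near-exact pairs have uniformly small autocorrelations on both sides

For Boolean `g` on `n` bits write `Δ_g(a) = Σ_y (-1)^{g(y) ⊕ g(y ⊕ a)}` for the autocorrelation (the bias of the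
derivative `D_a g`; `Δ_g(0) = 2ⁿ`, and `g` is bent iff `Δ_g(a) = 0` for all `a ≠ 0`).  For ALL Boolean `f, g` on
`n` bits and every `a ≠ 0` (no degree hypothesis, any `n`):

  **`Δ_g(a)² ≤ 4·4ⁿ·(1 − Φ(f,g)²)`**,  i.e.  `|Δ_g(a)| ≤ 2^{n+1} √(1 − Φ(f,g)²)`     (`db_autocorr_sq_le`, `db_abs_autocorr_le`)

and the same for `Δ_f` (`db_autocorr_sq_le_left`, symmetry of `Φ`).  Proof: Wiener–Khinchin
`Σ_x W_g(x)² (-1)^{a·x} = 2ⁿ Δ_g(a)` (`db_sum_W_sq_twist`, via the tree's `sum_twist_mul_dwt`), orthogonality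
`Σ_x (-1)^{a·x} = 0` to subtract the bent level `K² = 2ⁿ`, the factorisation `W² − K² = (W − Kσ_f)(W + Kσ_f)`
(`σ_f = (-1)^f`), Cauchy–Schwarz, and the two defect energies `Σ (W_g ∓ Kσ_f)² = 2·4ⁿ(1 ∓ Φ)` (`hl_defect_energy` for `f`
and for `¬f`, with the landed `SmallCases.forrelation_bnot_left`).  Consequences:

* `db_forrelation_sq_le_of_bias`: if `|Δ_g(a)| ≥ 2^{n−h}` for some `a ≠ 0` then `Φ(f,g)² ≤ 1 − 4^{−(h+1)}` for EVERY
  `f`.  For CUBIC `g` every derivative `D_a g` is quadratic, so `|Δ_g(a)| ∈ {0} ∪ {2^{n−h} : 2h = rank D_a g}`: a cubic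
  `g` with an UNBALANCED derivative of symplectic rank `2h` is capped at `Φ² ≤ 1 − 4^{−(h+1)}` against all partners
  (`h = 0`, a linear structure: `Φ² ≤ 3/4`, cf. the sharper `1/2` of `Negative/LinearStructure`; `h = 1`: `Φ < 31/32`;
  `h = 2`: `Φ < 127/128`).  Hence along any family with `Φ → 1⁻` (a counterexample to `NearExactIsExact`) EVERY
  unbalanced derivative direction must have rank `→ ∞` on both sides — the pair is "asymptotically bent" in the
  autocorrelation (GAC absolute-indicator) sense, uniformly over all `2ⁿ − 1` directions;
* `db_exact_autocorr_eq_zero`: at `Φ(f,g)² = 1` all `Δ_g(a)`, `a ≠ 0`, vanish (an exact pair has perfectly balanced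
  derivatives on both sides — bentness, recovered without Parseval-uniqueness arguments).

Use in the cell: DISPROOF.md §37.  HONEST FRAMING: a structural constraint on near-exact pairs (value = theorem), NOT
summit progress; it neither proves nor refutes `NearExactIsExact`.  Standard axioms.  The Wiener–Khinchin relation is
[cite: Carlet2020, Rel. (2.53)]; the rest is [folklore].
-/

set_option linter.dupNamespace false -- D-0017: single-problem summit ⇒ `QuantumAdvantage.QuantumAdvantage` by design

noncomputable section

namespace Summit.QuantumAdvantage.QuantumAdvantage.Theorems.NearExactIsExact.Negative.DerivativeBias

open Finset
open Literature.Computability.QuantumComplexity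
open Literature.Computability.QuantumComplexity.BuzetChailloux (bxor zeroVec signOf_sq bxor_comm bxor_eq_zeroVec_iff)
open Literature.Computability.QuantumComplexity.DerivativeWalsh (W dwt sum_twist_mul_dwt signOf_not twist_bxor_left)
open Literature.Computability.QuantumComplexity.Simon (twist_sq sum_twist)
open Literature.Computability.QuantumComplexity.MMReadout (forrelation_symm')
open Summit.QuantumAdvantage.QuantumAdvantage.Theorems.NearExactIsExact.Negative.HyperplaneLeak
  (hl_defect_energy)
open Summit.QuantumAdvantage.QuantumAdvantage.Theorems.NearExactIsExact.Negative.SmallCases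
  (forrelation_bnot_left)

variable {n : ℕ}

/-! ### Wiener–Khinchin: the twisted second moment of `W_g` is the autocorrelation -/

/-- `W_G(x)² = Σ_u (-1)^{u·x} T_G(u, 0)` — the frequency-`0` column of the tree's derivative Walsh table
(`sum_twist_mul_dwt` at `h = 0`). [cite: Carlet2020, Rel. (2.53)] -/
theorem db_W_sq (G : (Fin n → Bool) → ℝ) (x : Fin n → Bool) :
    W G x ^ 2 = ∑ u, twist u x * dwt G u zeroVec := by
  rw [sum_twist_mul_dwt, sq, W]
  congr 1
  refine sum_congr rfl fun y _ => ?_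
  rw [show twist zeroVec y = 1 by simp [twist, zeroVec], mul_one]

/-- **Wiener–Khinchin over `𝔽₂ⁿ`**: `Σ_x W_G(x)² (-1)^{a·x} = 2ⁿ · T_G(a, 0) = 2ⁿ Σ_y G(y) G(y ⊕ a)`.
[cite: Carlet2020, Rel. (2.53)] -/
theorem db_sum_W_sq_twist (G : (Fin n → Bool) → ℝ) (a : Fin n → Bool) :
    ∑ x, W G x ^ 2 * twist a x = (2 : ℝ) ^ n * dwt G a zeroVec := by
  simp_rw [db_W_sq, sum_mul]
  rw [sum_comm]
  have e : ∀ u : Fin n → Bool, ∑ x, twist u x * dwt G u zeroVec * twist a x =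
      dwt G u zeroVec * (if bxor u a = zeroVec then (2 : ℝ) ^ n else 0) := by
    intro u
    rw [show zeroVec = (fun _ : Fin n => false) from rfl, ← sum_twist (bxor u a), mul_sum]
    refine sum_congr rfl fun x _ => ?_
    rw [twist_bxor_left]; ring
  simp_rw [e, bxor_eq_zeroVec_iff, mul_ite, mul_zero]
  rw [Finset.sum_ite_eq' univ a, if_pos (mem_univ _), mul_comm]

/-- The autocorrelation as the table entry: `T_G(a,0) = Σ_y G(y) G(y ⊕ a)`. [folklore] -/
theorem db_dwt_zero (G : (Fin n → Bool) → ℝ) (a : Fin n → Bool) :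
    dwt G a zeroVec = ∑ y, G y * G (bxor y a) := by
  rw [dwt]
  exact sum_congr rfl fun y _ => by rw [show twist zeroVec y = 1 by simp [twist, zeroVec], mul_one]

/-! ### The two defect energies -/

/-- The PLUS energy: `Σ_x (W_g(x) + √(2ⁿ)(-1)^{f x})² = 2·(2ⁿ)²·(1 + Φ(f,g))`. [folklore] -/
theorem db_plus_energy (f g : (Fin n → Bool) → Bool) :
    ∑ x, (W (fun y => signOf (g y)) x + Real.sqrt ((2 : ℝ) ^ n) * signOf (f x)) ^ 2 =
      2 * ((2 : ℝ) ^ n) ^ 2 * (1 + forrelation f g) := by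
  have h := hl_defect_energy (fun x => !f x) g
  simp_rw [signOf_not, mul_neg, sub_neg_eq_add] at h
  rw [h, forrelation_bnot_left]
  ring

/-! ### The derivative-bias bound -/

/-- **Derivative-bias bound.** For ALL Boolean `f, g` on `n` bits and every `a ≠ 0`:
`(Σ_y (-1)^{g y}(-1)^{g(y ⊕ a)})² ≤ 4·4ⁿ·(1 − Φ(f,g)²)`. [folklore] -/
theorem db_autocorr_sq_le (f g : (Fin n → Bool) → Bool) {a : Fin n → Bool} (ha : a ≠ fun _ => false) :
    (∑ y, signOf (g y) * signOf (g (bxor y a))) ^ 2 ≤ 4 * (4 : ℝ) ^ n * (1 - forrelation f g ^ 2) := by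
  set K : ℝ := Real.sqrt ((2 : ℝ) ^ n) with hKdef
  have hK : K ^ 2 = (2 : ℝ) ^ n := Real.sq_sqrt (by positivity)
  -- Wiener–Khinchin and orthogonality: `2ⁿ Δ = Σ (W² − K²σ²)·twist = Σ ((W − Kσ) twist)(W + Kσ)`
  have hWK := db_sum_W_sq_twist (fun y => signOf (g y)) a
  rw [db_dwt_zero] at hWK
  have h0 : ∑ x : Fin n → Bool, K ^ 2 * twist a x = 0 := by rw [← mul_sum, sum_twist a, if_neg ha, mul_zero]
  have hrepr : (2 : ℝ) ^ n * ∑ y, signOf (g y) * signOf (g (bxor y a)) =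
      ∑ x, ((W (fun y => signOf (g y)) x - K * signOf (f x)) * twist a x) *
        (W (fun y => signOf (g y)) x + K * signOf (f x)) := by
    rw [← hWK, ← sub_zero (∑ x, W (fun y => signOf (g y)) x ^ 2 * twist a x), ← h0, ← sum_sub_distrib]
    refine sum_congr rfl fun x _ => ?_
    have hs : signOf (f x) ^ 2 = 1 := signOf_sq _
    linear_combination (K ^ 2 * twist a x) * hs
  -- Cauchy–Schwarz
  have hCS := sum_mul_sq_le_sq_mul_sq (univ : Finset (Fin n → Bool))
    (fun x => (W (fun y => signOf (g y)) x - K * signOf (f x)) * twist a x)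
    (fun x => W (fun y => signOf (g y)) x + K * signOf (f x))
  have hU : ∑ x, ((W (fun y => signOf (g y)) x - K * signOf (f x)) * twist a x) ^ 2 =
      2 * ((2 : ℝ) ^ n) ^ 2 * (1 - forrelation f g) := by
    rw [← hl_defect_energy f g]
    exact sum_congr rfl fun x _ => by rw [mul_pow, twist_sq, mul_one]
  rw [← hrepr, hU, db_plus_energy] at hCS
  -- `hCS : (2ⁿ Δ)² ≤ 2(2ⁿ)²(1−Φ) · 2(2ⁿ)²(1+Φ)`
  have hN : (0 : ℝ) < ((2 : ℝ) ^ n) ^ 2 := by positivity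
  have h4 : (4 : ℝ) ^ n = ((2 : ℝ) ^ n) ^ 2 := by rw [sq, ← mul_pow]; norm_num
  rw [h4]
  have key : ((2 : ℝ) ^ n) ^ 2 * (∑ y, signOf (g y) * signOf (g (bxor y a))) ^ 2 ≤
      ((2 : ℝ) ^ n) ^ 2 * (4 * ((2 : ℝ) ^ n) ^ 2 * (1 - forrelation f g ^ 2)) := by
    have e : ((2 : ℝ) ^ n * ∑ y, signOf (g y) * signOf (g (bxor y a))) ^ 2 =
        ((2 : ℝ) ^ n) ^ 2 * (∑ y, signOf (g y) * signOf (g (bxor y a))) ^ 2 := by ring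
    rw [← e]
    refine hCS.trans (le_of_eq ?_)
    ring
  exact le_of_mul_le_mul_left key hN

/-- **`|Δ_g(a)| ≤ 2^{n+1} √(1 − Φ(f,g)²)`** for `a ≠ 0` (all `f, g`, all `n`). [folklore] -/
theorem db_abs_autocorr_le (f g : (Fin n → Bool) → Bool) {a : Fin n → Bool} (ha : a ≠ fun _ => false) :
    |∑ y, signOf (g y) * signOf (g (bxor y a))| ≤
      2 * (2 : ℝ) ^ n * Real.sqrt (1 - forrelation f g ^ 2) := by
  have h := db_autocorr_sq_le f g ha
  have hpos : (0 : ℝ) ≤ 2 * (2 : ℝ) ^ n := by positivity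
  rw [← Real.sqrt_sq_eq_abs, show 2 * (2 : ℝ) ^ n = Real.sqrt ((2 * (2 : ℝ) ^ n) ^ 2) from
    (Real.sqrt_sq hpos).symm, ← Real.sqrt_mul (by positivity)]
  refine Real.sqrt_le_sqrt (h.trans (le_of_eq ?_))
  rw [show (4 : ℝ) ^ n = ((2 : ℝ) ^ n) ^ 2 by rw [sq, ← mul_pow]; norm_num]
  ring

/-- The bound on the `f` side: `Δ_f(a)² ≤ 4·4ⁿ(1 − Φ(f,g)²)` for `a ≠ 0`. [folklore] -/
theorem db_autocorr_sq_le_left (f g : (Fin n → Bool) → Bool) {a : Fin n → Bool} (ha : a ≠ fun _ => false) :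
    (∑ x, signOf (f x) * signOf (f (bxor x a))) ^ 2 ≤ 4 * (4 : ℝ) ^ n * (1 - forrelation f g ^ 2) := by
  rw [← forrelation_symm']
  exact db_autocorr_sq_le g f ha

/-- **A large derivative bias caps `Φ`.**  If `|Δ_g(a)| ≥ 2ⁿ/2ʰ` for some `a ≠ 0` (for cubic `g`: an unbalanced
derivative `D_a g` of symplectic rank `2h`), then `Φ(f,g)² ≤ 1 − 4^{−(h+1)}` for every `f`. [folklore] -/
theorem db_forrelation_sq_le_of_bias (f g : (Fin n → Bool) → Bool) {a : Fin n → Bool} (ha : a ≠ fun _ => false)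
    {h : ℕ} (hbias : (2 : ℝ) ^ n ≤ (2 : ℝ) ^ h * |∑ y, signOf (g y) * signOf (g (bxor y a))|) :
    forrelation f g ^ 2 ≤ 1 - 1 / (4 * (4 : ℝ) ^ h) := by
  have hb := db_autocorr_sq_le f g ha
  have h4n : (4 : ℝ) ^ n = ((2 : ℝ) ^ n) ^ 2 := by rw [sq, ← mul_pow]; norm_num
  have h4h : (4 : ℝ) ^ h = ((2 : ℝ) ^ h) ^ 2 := by rw [sq, ← mul_pow]; norm_num
  have hsq : (4 : ℝ) ^ n ≤ (4 : ℝ) ^ h * (∑ y, signOf (g y) * signOf (g (bxor y a))) ^ 2 := by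
    rw [h4n, h4h, ← sq_abs (∑ y, _), ← mul_pow]
    exact pow_le_pow_left₀ (by positivity) hbias 2
  have hposn : (0 : ℝ) < (4 : ℝ) ^ n := by positivity
  have hposh : (0 : ℝ) < 4 * (4 : ℝ) ^ h := by positivity
  -- `4ⁿ ≤ 4ʰ Δ² ≤ 4ʰ · 4 · 4ⁿ (1 − Φ²)`, divide by `4ⁿ`
  have hc : (4 : ℝ) ^ n * 1 ≤ (4 : ℝ) ^ n * (4 * (4 : ℝ) ^ h * (1 - forrelation f g ^ 2)) := by
    rw [mul_one]
    refine hsq.trans ?_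
    have := mul_le_mul_of_nonneg_left hb (by positivity : (0 : ℝ) ≤ (4 : ℝ) ^ h)
    refine this.trans (le_of_eq ?_)
    ring
  have hd := le_of_mul_le_mul_left hc hposn
  have he : 1 / (4 * (4 : ℝ) ^ h) ≤ 1 - forrelation f g ^ 2 := by
    rw [div_le_iff₀ hposh]
    linarith
  linarith

/-- The case `h = 0`: a LINEAR STRUCTURE `g(a ⊕ y) = g(y) ⊕ ε` (`|Δ_g(a)| = 2ⁿ`) gives `Φ(f,g)² ≤ 3/4` for every
`f` (the file `Negative/LinearStructure` has the sharper `1/2` by a direct hyperplane argument). [folklore] -/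
theorem db_forrelation_sq_le_of_linearStructure (f g : (Fin n → Bool) → Bool) {a : Fin n → Bool} {ε : Bool}
    (ha : a ≠ fun _ => false) (hg : ∀ y, g (bxor a y) = (g y ^^ ε)) :
    forrelation f g ^ 2 ≤ 3 / 4 := by
  have hΔ : ∑ y, signOf (g y) * signOf (g (bxor y a)) = signOf ε * (2 : ℝ) ^ n := by
    have e : ∀ y : Fin n → Bool, signOf (g y) * signOf (g (bxor y a)) = signOf ε := by
      intro y
      rw [bxor_comm, hg y, signOf_xor, ← mul_assoc, ← sq, signOf_sq, one_mul]
    simp_rw [e]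
    rw [sum_const, card_univ, Fintype.card_fun, Fintype.card_bool, Fintype.card_fin]
    simp [mul_comm]
  have habs : |∑ y, signOf (g y) * signOf (g (bxor y a))| = (2 : ℝ) ^ n := by
    rw [hΔ, abs_mul, show |signOf ε| = 1 by cases ε <;> simp [signOf], one_mul,
      abs_of_nonneg (by positivity)]
  have h := db_forrelation_sq_le_of_bias f g ha (h := 0) (by rw [habs]; simp)
  norm_num at h
  linarith

/-- **Exact pairs are balanced in every direction**: `Φ(f,g)² = 1 ⇒ Δ_g(a) = 0` for all `a ≠ 0` (bentness of `g`
in the autocorrelation form). [folklore] -/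
theorem db_exact_autocorr_eq_zero (f g : (Fin n → Bool) → Bool) (h1 : forrelation f g ^ 2 = 1)
    {a : Fin n → Bool} (ha : a ≠ fun _ => false) :
    ∑ y, signOf (g y) * signOf (g (bxor y a)) = 0 := by
  have h := db_autocorr_sq_le f g ha
  rw [h1, sub_self, mul_zero] at h
  exact pow_eq_zero_iff (n := 2) (by norm_num) |>.1 (le_antisymm h (sq_nonneg _))

end Summit.QuantumAdvantage.QuantumAdvantage.Theorems.NearExactIsExact.Negative.DerivativeBias
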